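/-
Copyright: public domain mathematics (folklore). Lean formalisation for the H21 tree.
-/
import Literature.ModelTheory.Zilber.EACDensityTransport
import Literature.ModelTheory.Zilber.EACDensityAligned
import HarnessLib

/-!
# EACDensityLineTwist — the fibre twist: all lines of non-real slope, monomial fibres, aligned lines

Twelfth file of the `pub-schanuel` cell's seat 1 on the typed Mantova–Masser density question
(`EACDensityQuestion`: for `W ⊆ ℂ² × (ℂˣ)²` in the case "dim-π-S-1-free"
(`MMCaseDimPiOneFree W`), are the exponential points Zariski dense, `UnprojectedDense W`?).

**HONEST FRAMING.** These are modest, kernel-checked instances of an OPEN QUESTION about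
Zilber's Exponential-Algebraic-Closedness conjecture in the smallest non-trivial case; nothing
here bears on Schanuel's conjecture (EAC ⇏ SC), and the cell's headline rung
`Literature.ModelTheory.Zilber.ECCell 3 2` stays open.

## What is new

`EACDensityTransport` made the question invariant under `GL₂(ℤ) ⋉ ℂ²` and the index swap.  This
file USES the invariance to settle new cases with no new analysis:

* **Part 1 — the fibre twist.** `(1 -m; 0 1) ∈ SL₂(ℤ)` maps the line surface
  `{x₁ = a x₀ + b, y₀ = y₁^m q₁(y₁)}` onto `{x₁ = a' x₀ + b', y₀ = q₁(y₁)}` with the tilted slope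
  `a' = a/(1 - m a)`, `Im a' = Im a/|1 - m a|²` (`latticeClosure_fibreTwistMat_lineSurface`,
  `unprojectedDense_lineSurface_pow_mul_iff`).  Consequence
  (`unprojectedDense_lineSurface_of_ne_zero`,
  `unprojectedDensityQuestion_instance_line_of_ne_zero`):
  **every** line surface `{x₁ = a x₀ + b, y₀ = q(y₁)}` with `Im a ≠ 0` and `q ≠ 0` is in the case
  and has Zariski dense exponential points — `EACDensityFamilies.unprojectedDense_lineSurface`
  needed `q(0) ≠ 0` (its escape regime `e^z ≈ q(0)` does not exist when `q(0) = 0`; the twist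
  replaces it by the regime `e^z ≈ c y₁^m` without redoing the contraction argument).
* **Part 2 — monomial fibres over any irrational slope.** For `q = c y₁^m` the twist lands on a
  constant fibre, decided by `EACDensityPhases`: `{x₁ = a x₀ + b, y₀ = c y₁^m}` (`c ≠ 0`,
  `1 - m a ≠ 0`) has dense exponential points **iff `a ∉ ℚ`**
  (`unprojectedDense_line_monomial_iff`),
  in particular for every REAL irrational slope, where no escape regime exists at all
  (`unprojectedDensityQuestion_instance_line_monomial`; example `e^z = 2 e^{3√2 z}`).  Monomial
  fibres are multiplicatively DEPENDENT (`not_isMulFree_line_monomial`): these are instances of the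
  question as Mantova–Masser typed it — on this family "in the case" and "dense" coincide — not of
  its repaired, multiplicatively free form (`EACDensityOscillatory`).
* **Part 3 — aligned line surfaces.** `{x₁ = a x₀ + b, y₁ = q(y₀)}` is the index swap of the line
  surface of slope `a⁻¹` (`alignedSurface_line_eq_indexSwapped`), so: in the case iff `a ∉ ℚ`
  (`mmCase_alignedSurface_line`), dense for `Im a ≠ 0` and every `q ≠ 0`
  (`unprojectedDensityQuestion_instance_aligned_line`), and for monomial `q` dense iff `a ∉ ℚ`
  (`unprojectedDense_alignedSurface_line_monomial_iff`,
  `unprojectedDensityQuestion_instance_aligned_line_monomial`).  With `EACDensityAligned`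
  (`deg r ≥ 2`, all `q ≠ 0`) the aligned family `A_{r,q}` is decided to the same extent as the
  crossed one.

## Context in print

Existence of exponential points on `L × C` (`L ⊆ ℂ²` a line of irrational slope, `C ⊆ (ℂˣ)²` a
curve, `L × C` free and rotund) is known: Gallinaro, Selecta Math. 29 (2023) Thm 8.8 (any linear
`L`, any `n`), and for `n = 2` Mantova–Masser, Proc. LMS 129 (2024) Thm 1.2 (`π(Z)` is infinite).
Zariski density of the UNPROJECTED points is what Mantova–Masser call "unclear, even for `n = 2`"
(loc. cit. p. 5); the theorems below decide it for all non-real slopes and for monomial fibres, by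
symmetry alone.  No statement of these papers is used as a hypothesis.

## State of the two graph families after this file

Crossed `S_{p,q} = {x₁ = p(x₀), y₀ = q(y₁)}` and aligned `A_{r,q} = {x₁ = r(x₀), y₁ = q(y₀)}`
(`q ≠ 0`), and their index swaps: base of degree `≥ 2` — ALL decided (dense;
`EACDensityCrossed`, `EACDensityAligned`, constants by `EACDensityPhases`); base of degree `0` or a
line of rational slope — not in the case (`mmCase_graphPolySurface_line_iff`); line of slope `a`
with `Im a ≠ 0` — dense for every `q` (this file); `a ∈ ℝ \ ℚ` with `q` a monomial — dense (this
file); `a ∈ ℝ \ ℚ` with `q` not a monomial — OPEN (after the twist one may assume `q(0) ≠ 0`; the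
exponential polynomial `e^z - q(e^{az+b})` then has real frequencies, all zeros in a vertical
strip and no degenerating regime: a common-zero statement for such exponential polynomials is the
missing input).  The FREE question for a general surface of the case — what the `EC(3,2)` bridges
consume — is untouched and OPEN.

Tags: every declaration is elementary algebra over the cited tree theorems — `[folklore]`.
-/

noncomputable section

open MvPolynomial Matrix Complex

namespace Literature.ModelTheory.Zilber

open Literature.NumberTheory.Transcendental
open Literature.ModelTheory.ExponentialFields

/-! ## Part 1 — lines of non-real slope with ARBITRARY fibre polynomial, by transport

`EACDensityFamilies` proved density for `{x₁ = a x₀ + b, y₀ = q(y₁)}` when `Im a ≠ 0` and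
`q(0) ≠ 0`.  The fibre twist `(1 -m; 0 1) ∈ SL₂(ℤ)` divides the fibre equation by `y₁^m`
(`m` = the order of `q` at `0`) and tilts the slope to `a/(1 - m a)` (still non-real): the case
`q(0) = 0` is the `(1 -m; 0 1)`-transform of the case `q(0) ≠ 0` — no further analysis. -/

section LinesAllFibres

variable {K : Type*} [Field K]

/-- The fibre twist `(1 -m; 0 1)`: `(x₀, x₁, y₀, y₁) ↦ (x₀ - m x₁, x₁, y₀ y₁^{-m}, y₁)`.
[folklore] -/
def fibreTwistMat (m : ℕ) : Matrix (Fin 2) (Fin 2) ℤ := !![1, -(m : ℤ); 0, 1]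

/-- `(1 -m; 0 1)(1 m; 0 1) = 1`. [folklore] -/
theorem fibreTwistMat_mul (m : ℕ) : fibreTwistMat m * !![1, (m : ℤ); 0, 1] = 1 := by
  simp [fibreTwistMat, Matrix.one_fin_two]

/-- `(1 m; 0 1)(1 -m; 0 1) = 1`. [folklore] -/
theorem mul_fibreTwistMat (m : ℕ) : !![1, (m : ℤ); 0, 1] * fibreTwistMat m = 1 := by
  simp [fibreTwistMat, Matrix.one_fin_two]

/-- The fibre twist on points, coordinatewise. [folklore] -/
theorem latticeChange_fibreTwistMat (m : ℕ) (z : Fin 2 ⊕ Fin 2 → K) :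
    latticeChange (fibreTwistMat m) z =
      Sum.elim ![z (Sum.inl 0) - (m : K) * z (Sum.inl 1), z (Sum.inl 1)]
        ![z (Sum.inr 0) * (z (Sum.inr 1) ^ m)⁻¹, z (Sum.inr 1)] := by
  funext k
  rcases k with i | i
  · rw [latticeChange_inl]
    fin_cases i
    · simp [intLinMap, fibreTwistMat, Fin.sum_univ_two, projAdd_apply, sub_eq_add_neg]
    · simp [intLinMap, fibreTwistMat, Fin.sum_univ_two, projAdd_apply]
  · rw [latticeChange_inr]
    fin_cases i
    · simp [monomialMap, fibreTwistMat, Fin.prod_univ_two, projMul_apply, _root_.zpow_neg]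
    · simp [monomialMap, fibreTwistMat, Fin.prod_univ_two, projMul_apply]

/-- **The fibre twist of a line surface**: for `λ = 1 - m a ≠ 0`,
`Φ_{(1 -m; 0 1)}({x₁ = a x₀ + b, y₀ = y₁^m q₁(y₁)} ∩ G²) = {x₁ = (a/λ) x₀ + b/λ, y₀ = q₁(y₁)} ∩ G²`.
[folklore] -/
theorem latticeImage_fibreTwistMat_lineSurface (a b : ℂ) (m : ℕ) (q₁ : Polynomial ℂ)
    (hl : (1 : ℂ) - m * a ≠ 0) :
    latticeImage (fibreTwistMat m) (graphPolySurface (linePoly a b) (Polynomial.X ^ m * q₁)) =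
      graphPolySurface (linePoly (a / (1 - m * a)) (b / (1 - m * a))) q₁ ∩ torusLocus ℂ 2 := by
  ext z
  simp only [latticeImage, Set.mem_image, Set.mem_inter_iff, mem_graphPolySurface_iff,
    eval_linePoly, Polynomial.eval_mul, Polynomial.eval_pow, Polynomial.eval_X, mem_torusLocus_iff]
  constructor
  · rintro ⟨w, ⟨⟨hw1, hw0⟩, hwT⟩, rfl⟩
    have hT0 : w (Sum.inr 0) ≠ 0 := hwT 0
    have hT1 : w (Sum.inr 1) ≠ 0 := hwT 1
    rw [latticeChange_fibreTwistMat]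
    simp only [Sum.elim_inl, Sum.elim_inr, Matrix.cons_val_zero, Matrix.cons_val_one,
      Matrix.cons_val_fin_one]
    refine ⟨⟨?_, ?_⟩, fun i => ?_⟩
    · rw [hw1, div_mul_eq_mul_div, ← add_div, eq_div_iff hl]
      ring
    · rw [hw0, mul_comm, ← mul_assoc, inv_mul_cancel₀ (pow_ne_zero m hT1), one_mul]
    · fin_cases i
      · simpa using mul_ne_zero hT0 (inv_ne_zero (pow_ne_zero m hT1))
      · simpa using hT1
  · rintro ⟨⟨h1, h0⟩, hT⟩
    have hT0 : z (Sum.inr 0) ≠ 0 := hT 0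
    have hT1 : z (Sum.inr 1) ≠ 0 := hT 1
    refine ⟨Sum.elim ![z (Sum.inl 0) + (m : ℂ) * z (Sum.inl 1), z (Sum.inl 1)]
      ![z (Sum.inr 0) * z (Sum.inr 1) ^ m, z (Sum.inr 1)], ⟨⟨?_, ?_⟩, fun i => ?_⟩, ?_⟩
    · simp only [Sum.elim_inl, Matrix.cons_val_one, Matrix.cons_val_fin_one, Matrix.cons_val_zero]
      have e : z (Sum.inl 1) * (1 - m * a) = a * z (Sum.inl 0) + b := by
        rw [h1, div_mul_eq_mul_div, ← add_div, div_mul_cancel₀ _ hl]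
      linear_combination e
    · simp only [Sum.elim_inr, Matrix.cons_val_zero, Matrix.cons_val_one, Matrix.cons_val_fin_one]
      rw [h0]
      ring
    · fin_cases i
      · simpa using mul_ne_zero hT0 (pow_ne_zero m hT1)
      · simpa using hT1
    · rw [latticeChange_fibreTwistMat]
      funext k
      rcases k with i | i
      · fin_cases i
        · simp only [Fin.zero_eta, Fin.isValue, Sum.elim_inl, Matrix.cons_val_zero,
            Matrix.cons_val_one, Matrix.cons_val_fin_one]
          ring
        · simp
      · fin_cases i
        · simp only [Fin.zero_eta, Fin.isValue, Sum.elim_inr, Matrix.cons_val_zero,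
            Matrix.cons_val_one, Matrix.cons_val_fin_one]
          rw [mul_assoc, mul_inv_cancel₀ (pow_ne_zero m hT1), mul_one]
        · simp

/-- **`{x₁ = a x₀ + b, y₀ = y₁^m q₁(y₁)}^{(1 -m; 0 1)} = {x₁ = (a/λ) x₀ + b/λ, y₀ = q₁(y₁)}`**
(`λ = 1 - m a ≠ 0`, `q₁ ≠ 0`). [folklore] -/
theorem latticeClosure_fibreTwistMat_lineSurface (a b : ℂ) (m : ℕ) {q₁ : Polynomial ℂ}
    (hq₁ : q₁ ≠ 0) (hl : (1 : ℂ) - m * a ≠ 0) :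
    latticeClosure (fibreTwistMat m) (graphPolySurface (linePoly a b) (Polynomial.X ^ m * q₁)) =
      graphPolySurface (linePoly (a / (1 - m * a)) (b / (1 - m * a))) q₁ :=
  latticeClosure_eq_of_latticeImage_eq _ (isIrreducibleClosed_graphPolySurface _ _)
    (graphPolySurface_inter_torusLocus_nonempty _ hq₁)
    (latticeImage_fibreTwistMat_lineSurface a b m q₁ hl)

/-- Hence **density is invariant under the fibre twist** (`λ = 1 - m a ≠ 0`, `q₁ ≠ 0`).
[folklore] -/
theorem unprojectedDense_lineSurface_pow_mul_iff (a b : ℂ) (m : ℕ) {q₁ : Polynomial ℂ}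
    (hq₁ : q₁ ≠ 0) (hl : (1 : ℂ) - m * a ≠ 0) :
    UnprojectedDense (graphPolySurface (linePoly a b) (Polynomial.X ^ m * q₁)) ↔
      UnprojectedDense (graphPolySurface (linePoly (a / (1 - m * a)) (b / (1 - m * a))) q₁) := by
  rw [← latticeClosure_fibreTwistMat_lineSurface a b m hq₁ hl]
  exact (unprojectedDense_latticeClosure_iff (fibreTwistMat_mul m) (mul_fibreTwistMat m)
    (isIrreducibleClosed_graphPolySurface _ _) (graphPolySurface_inter_torusLocus_nonempty _
      (mul_ne_zero (pow_ne_zero _ Polynomial.X_ne_zero) hq₁))).symm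

/-- The tilted slope has imaginary part `Im a / |1 - m a|²`. [folklore] -/
theorem im_div_one_sub_natCast_mul (a : ℂ) (m : ℕ) :
    (a / (1 - m * a)).im = a.im / Complex.normSq (1 - m * a) := by
  rw [Complex.div_im]
  simp only [Complex.sub_re, Complex.one_re, Complex.mul_re, Complex.natCast_re,
    Complex.natCast_im, zero_mul, sub_zero, Complex.sub_im, Complex.one_im, Complex.mul_im,
    add_zero, zero_sub]
  ring

/-- `1 - m a ≠ 0` for non-real `a`. [folklore] -/
theorem one_sub_natCast_mul_ne_zero {a : ℂ} (ha : a.im ≠ 0) (m : ℕ) : (1 : ℂ) - m * a ≠ 0 := by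
  intro h
  have him : ((1 : ℂ) - m * a).im = 0 := by rw [h, Complex.zero_im]
  have hre : ((1 : ℂ) - m * a).re = 0 := by rw [h, Complex.zero_re]
  simp only [Complex.sub_im, Complex.one_im, Complex.mul_im, Complex.natCast_re,
    Complex.natCast_im, zero_mul, add_zero, zero_sub, neg_eq_zero, mul_eq_zero,
    Nat.cast_eq_zero] at him
  simp only [Complex.sub_re, Complex.one_re, Complex.mul_re, Complex.natCast_re,
    Complex.natCast_im, zero_mul, sub_zero] at hre
  rcases him with hm | hai
  · rw [hm, Nat.cast_zero, zero_mul, sub_zero] at hre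
    exact one_ne_zero hre
  · exact ha hai

/-- **Unprojected density for ALL line surfaces of non-real slope**: `{x₁ = a x₀ + b, y₀ = q(y₁)}`
with `Im a ≠ 0` and `q ≠ 0` has Zariski dense exponential points — `EACDensityFamilies`'
`unprojectedDense_lineSurface` needed `q(0) ≠ 0`; the fibre twist by the order `m` of `q` at `0`
removes that hypothesis. (new in this file) [folklore] -/
theorem unprojectedDense_lineSurface_of_ne_zero {a : ℂ} (b : ℂ) {q : Polynomial ℂ}
    (ha : a.im ≠ 0) (hq : q ≠ 0) : UnprojectedDense (graphPolySurface (linePoly a b) q) := by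
  classical
  obtain ⟨q₁, hfac, hndvd⟩ := Polynomial.exists_eq_pow_rootMultiplicity_mul_and_not_dvd q hq 0
  rw [map_zero, sub_zero] at hfac hndvd
  set m := Polynomial.rootMultiplicity 0 q
  have hq₁0 : q₁.eval 0 ≠ 0 := by
    rwa [← Polynomial.coeff_zero_eq_eval_zero, ne_eq, ← Polynomial.X_dvd_iff]
  have hq₁ : q₁ ≠ 0 := by
    rintro rfl
    exact hq₁0 (Polynomial.eval_zero)
  have hl : (1 : ℂ) - m * a ≠ 0 := one_sub_natCast_mul_ne_zero ha m
  have ha' : (a / (1 - m * a)).im ≠ 0 := by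
    rw [im_div_one_sub_natCast_mul]
    exact div_ne_zero ha (by rwa [ne_eq, Complex.normSq_eq_zero])
  rw [hfac, unprojectedDense_lineSurface_pow_mul_iff a b m hq₁ hl]
  exact unprojectedDense_lineSurface _ q₁ ha' hq₁0

/-- **The question holds on the whole family of line surfaces of non-real slope** (`Im a ≠ 0`,
`q ≠ 0`): case (dim-pi-S-1-free) and Zariski density of the exponential points. [folklore] -/
theorem unprojectedDensityQuestion_instance_line_of_ne_zero {a : ℂ} (b : ℂ) {q : Polynomial ℂ}
    (ha : a.im ≠ 0) (hq : q ≠ 0) :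
    MMCaseDimPiOneFree (graphPolySurface (linePoly a b) q) ∧
      UnprojectedDense (graphPolySurface (linePoly a b) q) :=
  ⟨mmCase_lineSurface b q ha hq, unprojectedDense_lineSurface_of_ne_zero b ha hq⟩

/-- Example: `e^{z} = e^{2iz} + e^{3iz}` — the exponential points of `{x₁ = i x₀, y₀ = y₁² + y₁³}`
(`q(0) = 0`, outside `EACDensityFamilies`' theorem) are Zariski dense. [folklore] -/
example :
    UnprojectedDense (graphPolySurface (linePoly I 0) (Polynomial.X ^ 2 + Polynomial.X ^ 3)) :=
  unprojectedDense_lineSurface_of_ne_zero 0 (by simp) (by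
    intro h
    have := congrArg (Polynomial.eval (1 : ℂ)) h
    norm_num at this)


/-! ## Part 2 — monomial fibres over lines of any irrational slope

For `q = c y₁^m` the fibre twist lands on a CONSTANT fibre, decided by `EACDensityPhases`
(`unprojectedDense_line_const_iff`): density `⟺` the tilted slope `a/(1 - m a)` is irrational
`⟺ a` is irrational.  This covers real irrational slopes too, where no escape regime exists. -/

/-- `a/(1 - m a) ∉ ℚ ⟺ a ∉ ℚ` (for `1 - m a ≠ 0`): the twist is a rational Möbius map. [folklore] -/
theorem forall_rat_ne_div_one_sub_iff {a : ℂ} (m : ℕ) (hl : (1 : ℂ) - m * a ≠ 0) :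
    (∀ r : ℚ, a / (1 - m * a) ≠ (r : ℂ)) ↔ ∀ r : ℚ, a ≠ (r : ℂ) := by
  constructor
  · intro h r har
    apply h (r / (1 - m * r))
    rw [har]
    norm_cast
  · intro h r e
    have e' : a = r * (1 - m * a) := by rwa [div_eq_iff hl] at e
    have h1 : (1 : ℂ) + m * r ≠ 0 := by
      intro h0
      have hr0 : (r : ℂ) = 0 := by linear_combination (-1 : ℂ) * e' + a * h0
      apply h 0
      rw [Rat.cast_zero, e', hr0, zero_mul]
    apply h (r / (1 + m * r))
    push_cast
    rw [eq_div_iff h1]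
    linear_combination e'

/-- `1 - m a ≠ 0` for irrational `a`. [folklore] -/
theorem one_sub_natCast_mul_ne_zero_of_forall_rat_ne {a : ℂ} (ha : ∀ r : ℚ, a ≠ (r : ℂ)) (m : ℕ) :
    (1 : ℂ) - m * a ≠ 0 := by
  intro h
  rcases Nat.eq_zero_or_pos m with hm | hm
  · simp [hm] at h
  · apply ha (1 / m)
    push_cast
    rw [eq_div_iff (by exact_mod_cast hm.ne' : (m : ℂ) ≠ 0)]
    linear_combination (-1 : ℂ) * h

/-- **Monomial fibres over a line**: for `c ≠ 0` and `1 - m a ≠ 0`, the exponential points of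
`{x₁ = a x₀ + b, y₀ = c y₁^m}` are Zariski dense iff `a ∉ ℚ` — by the fibre twist onto the constant
fibre `y₀ = c` over the line of slope `a/(1 - m a)` and `EACDensityPhases`. (new) [folklore] -/
theorem unprojectedDense_line_monomial_iff (a b : ℂ) (m : ℕ) {c : ℂ} (hc : c ≠ 0)
    (hl : (1 : ℂ) - m * a ≠ 0) :
    UnprojectedDense (graphPolySurface (linePoly a b) (Polynomial.X ^ m * Polynomial.C c)) ↔
      ∀ r : ℚ, a ≠ (r : ℂ) := by
  rw [unprojectedDense_lineSurface_pow_mul_iff a b m (Polynomial.C_ne_zero.2 hc) hl,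
    unprojectedDense_line_const_iff (Complex.exp_log hc), forall_rat_ne_div_one_sub_iff m hl]

/-- Monomial fibres are multiplicatively DEPENDENT (`y₀ y₁^{-m} = c` on the surface): these are
instances of the question exactly as Mantova–Masser typed it, not of its repaired (free) form —
transported from `not_isMulFree_graphPolySurface_C` along the fibre twist. [folklore] -/
theorem not_isMulFree_line_monomial (a b : ℂ) (m : ℕ) {c : ℂ} (hc : c ≠ 0)
    (hl : (1 : ℂ) - m * a ≠ 0) :
    ¬ IsMulFree ℂ 2 (graphPolySurface (linePoly a b) (Polynomial.X ^ m * Polynomial.C c) ∩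
      torusLocus ℂ 2) := by
  intro h
  refine not_isMulFree_graphPolySurface_C (linePoly (a / (1 - m * a)) (b / (1 - m * a))) c ?_
  rw [← latticeClosure_fibreTwistMat_lineSurface a b m (Polynomial.C_ne_zero.2 hc) hl]
  exact isMulFree_latticeClosure_inter (fibreTwistMat_mul m) (mul_fibreTwistMat m)
    (isIrreducibleClosed_graphPolySurface _ _).1 h

/-- **The question holds for monomial fibres over every line of irrational slope** (`a ∉ ℚ`,
possibly real; `c ≠ 0`): `{x₁ = a x₀ + b, y₀ = c y₁^m}` is in the case AND has dense exponential
points. [folklore] -/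
theorem unprojectedDensityQuestion_instance_line_monomial {a : ℂ} (b : ℂ) (m : ℕ) {c : ℂ}
    (ha : ∀ r : ℚ, a ≠ (r : ℂ)) (hc : c ≠ 0) :
    MMCaseDimPiOneFree (graphPolySurface (linePoly a b) (Polynomial.X ^ m * Polynomial.C c)) ∧
      UnprojectedDense (graphPolySurface (linePoly a b) (Polynomial.X ^ m * Polynomial.C c)) :=
  ⟨mmCase_graphPolySurface_line ha
      (mul_ne_zero (pow_ne_zero _ Polynomial.X_ne_zero) (Polynomial.C_ne_zero.2 hc)),
    (unprojectedDense_line_monomial_iff a b m hc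
      (one_sub_natCast_mul_ne_zero_of_forall_rat_ne ha m)).2 ha⟩

/-- Example: `e^{z} = 2 e^{3√2 z}` — the exponential points of `{x₁ = √2 x₀, y₀ = 2 y₁³}` (real
irrational slope: no escape regime, `|e^{x₁}|` is pinned to `|e^{x₀}|^{√2}`) are Zariski dense.
[folklore] -/
example : UnprojectedDense (graphPolySurface (linePoly (Real.sqrt 2 : ℂ) 0)
    (Polynomial.X ^ 3 * Polynomial.C 2)) :=
  (unprojectedDensityQuestion_instance_line_monomial 0 3 (fun r h =>
    (irrational_sqrt_two.ne_rat r) (by exact_mod_cast h)) two_ne_zero).2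

/-! ### Normal form of the line node

After the twist every line surface `{x₁ = a x₀ + b, y₀ = q(y₁)}` (`q ≠ 0`, `1 - m a ≠ 0` for the
order `m` of `q` at `0`) is density-equivalent to one with `q(0) ≠ 0`
(`unprojectedDense_lineSurface_pow_mul_iff`).  Decided: `a ∈ ℚ` (not in the case,
`mmCase_graphPolySurface_line_iff`); `Im a ≠ 0` (dense, `unprojectedDense_lineSurface_of_ne_zero`);
`a ∈ ℝ \ ℚ` with monomial `q` (dense, `unprojectedDense_line_monomial_iff`).  OPEN: `a ∈ ℝ \ ℚ`
with `q` not a monomial — the one-variable exponential polynomial `e^{z} - q(e^{a z + b})` has all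
its zeros in a vertical strip and no degenerating regime; density there needs a common-zero /
transcendence input for exponential polynomials of real frequencies that the tree does not have. -/

end LinesAllFibres

/-! ## Part 3 — the aligned line surfaces `{x₁ = a x₀ + b, y₁ = q(y₀)}` by the index swap

`EACDensityAligned` decided `A_{r,q} = {x₁ = r(x₀), y₁ = q(y₀)}` for `deg r ≥ 2`.  For `deg r = 1`,
`A_{a x + b, q}` is the INDEX SWAP of the line surface `{x₁ = a⁻¹ x₀ - b/a, y₀ = q(y₁)}`
(slope `a⁻¹`: non-real iff `a` is, irrational iff `a` is), so Parts 1–2 transfer verbatim through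
`EACDensityTransport.unprojectedDense_indexSwapped_iff`. -/

section AlignedLines

/-- `{x₁ = a x₀ + b, y₁ = q(y₀)}` is the index swap of `{x₁ = a⁻¹ x₀ - b/a, y₀ = q(y₁)}` (`a ≠ 0`).
[folklore] -/
theorem alignedSurface_line_eq_indexSwapped {a : ℂ} (ha : a ≠ 0) (b : ℂ) (q : Polynomial ℂ) :
    alignedSurface (linePoly a b) q =
      indexSwapped (graphPolySurface (linePoly a⁻¹ (-(b / a))) q) := by
  ext z
  rw [mem_alignedSurface_iff, mem_indexSwapped_graphPolySurface_iff, eval_linePoly, eval_linePoly]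
  constructor
  · rintro ⟨h1, h2⟩
    refine ⟨?_, h2⟩
    rw [h1, mul_add, ← mul_assoc, inv_mul_cancel₀ ha, one_mul, div_eq_mul_inv, mul_comm b a⁻¹]
    ring
  · rintro ⟨h1, h2⟩
    refine ⟨?_, h2⟩
    rw [h1, mul_add, ← mul_assoc, mul_inv_cancel₀ ha, one_mul, mul_neg, mul_div_cancel₀ _ ha]
    ring

/-- `a⁻¹ ∉ ℚ ⟺ a ∉ ℚ`. [folklore] -/
theorem forall_rat_ne_inv_iff (a : ℂ) : (∀ r : ℚ, a⁻¹ ≠ (r : ℂ)) ↔ ∀ r : ℚ, a ≠ (r : ℂ) := by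
  constructor
  · intro h r har
    exact h r⁻¹ (by rw [Rat.cast_inv, har])
  · intro h r har
    exact h r⁻¹ (by rw [Rat.cast_inv, ← har, inv_inv])

/-- **Case certificate for aligned line surfaces**: `{x₁ = a x₀ + b, y₁ = q(y₀)}` (`q ≠ 0`) is in
the case (dim-pi-S-1-free) as soon as `a ∉ ℚ`. [folklore] -/
theorem mmCase_alignedSurface_line {a : ℂ} (b : ℂ) {q : Polynomial ℂ} (ha : ∀ r : ℚ, a ≠ (r : ℂ))
    (hq : q ≠ 0) : MMCaseDimPiOneFree (alignedSurface (linePoly a b) q) := by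
  have ha0 : a ≠ 0 := fun h => ha 0 (by rw [h, Rat.cast_zero])
  rw [alignedSurface_line_eq_indexSwapped ha0]
  exact mmCaseDimPiOneFree_indexSwapped
    (mmCase_graphPolySurface_line ((forall_rat_ne_inv_iff a).2 ha) hq)

/-- **Every aligned line surface of non-real slope has Zariski dense exponential points**
(`Im a ≠ 0`, `q ≠ 0`; the equation is `e^{a z + b} = q(e^{z})`). [folklore] -/
theorem unprojectedDense_alignedSurface_line_of_im_ne_zero {a : ℂ} (b : ℂ) {q : Polynomial ℂ}
    (ha : a.im ≠ 0) (hq : q ≠ 0) : UnprojectedDense (alignedSurface (linePoly a b) q) := by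
  have ha0 : a ≠ 0 := fun h => ha (by rw [h, Complex.zero_im])
  have ha' : (a⁻¹).im ≠ 0 := by
    rw [Complex.inv_im]
    exact div_ne_zero (neg_ne_zero.2 ha) (by rwa [ne_eq, Complex.normSq_eq_zero])
  rw [alignedSurface_line_eq_indexSwapped ha0, unprojectedDense_indexSwapped_iff]
  exact unprojectedDense_lineSurface_of_ne_zero _ ha' hq

/-- **The question holds on all aligned line surfaces of non-real slope.** Together with
`EACDensityAligned.unprojectedDensityQuestion_instance_aligned` (`deg r ≥ 2`) the aligned family
`{x₁ = r(x₀), y₁ = q(y₀)}` is now decided except for `r` of degree `1` with real irrational slope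
and non-monomial `q` (degree-`0` `r` and rational slopes are not in the case). [folklore] -/
theorem unprojectedDensityQuestion_instance_aligned_line {a : ℂ} (b : ℂ) {q : Polynomial ℂ}
    (ha : a.im ≠ 0) (hq : q ≠ 0) :
    MMCaseDimPiOneFree (alignedSurface (linePoly a b) q) ∧
      UnprojectedDense (alignedSurface (linePoly a b) q) :=
  ⟨mmCase_alignedSurface_line b (fun r h => ha (by rw [h, Complex.ratCast_im])) hq,
    unprojectedDense_alignedSurface_line_of_im_ne_zero b ha hq⟩

/-- **Aligned monomial fibres** `{x₁ = a x₀ + b, y₁ = c y₀^m}` (`c ≠ 0`, `a ≠ 0`, `a ≠ m`): dense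
exponential points iff `a ∉ ℚ`. [folklore] -/
theorem unprojectedDense_alignedSurface_line_monomial_iff {a : ℂ} (ha0 : a ≠ 0) (b : ℂ) (m : ℕ)
    {c : ℂ} (hc : c ≠ 0) (hl : (1 : ℂ) - m * a⁻¹ ≠ 0) :
    UnprojectedDense (alignedSurface (linePoly a b) (Polynomial.X ^ m * Polynomial.C c)) ↔
      ∀ r : ℚ, a ≠ (r : ℂ) := by
  rw [alignedSurface_line_eq_indexSwapped ha0, unprojectedDense_indexSwapped_iff,
    unprojectedDense_line_monomial_iff _ _ m hc hl, forall_rat_ne_inv_iff]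

/-- **The question holds for aligned monomial fibres over every irrational slope** (`a ∉ ℚ`,
possibly real; `c ≠ 0`): the exponential points of `{x₁ = a x₀ + b, y₁ = c y₀^m}` — the solutions
of `e^{a z + b} = c e^{m z}` — are Zariski dense, and the surface is in the case. [folklore] -/
theorem unprojectedDensityQuestion_instance_aligned_line_monomial {a : ℂ} (b : ℂ) (m : ℕ) {c : ℂ}
    (ha : ∀ r : ℚ, a ≠ (r : ℂ)) (hc : c ≠ 0) :
    MMCaseDimPiOneFree (alignedSurface (linePoly a b) (Polynomial.X ^ m * Polynomial.C c)) ∧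
      UnprojectedDense (alignedSurface (linePoly a b) (Polynomial.X ^ m * Polynomial.C c)) := by
  have ha0 : a ≠ 0 := fun h => ha 0 (by rw [h, Rat.cast_zero])
  refine ⟨mmCase_alignedSurface_line b ha
      (mul_ne_zero (pow_ne_zero _ Polynomial.X_ne_zero) (Polynomial.C_ne_zero.2 hc)), ?_⟩
  exact (unprojectedDense_alignedSurface_line_monomial_iff ha0 b m hc
    (one_sub_natCast_mul_ne_zero_of_forall_rat_ne ((forall_rat_ne_inv_iff a).2 ha) m)).2 ha

end AlignedLines

end Literature.ModelTheory.Zilber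

end
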